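import Literature.AlgebraicGeometry.Motives.HodgeThetaSubalgebraUnitaryTwoOddCore
import Literature.AlgebraicGeometry.Motives.HodgeThetaSubalgebraSymplecticRankTen
import Literature.AlgebraicGeometry.Motives.HodgeLieRealPlacesSl2
import HarnessLib

/-!
# A rational Lie subalgebra of `𝔲_K(V, ψ)` whose complexification contains `Θ` is all of `𝔲_K(V, ψ)` when `K` acts with multiplicities `(2, b)`, `b` odd — THEOREM L‴ (Ribet 1983, Thm. 3 at multiplicities `(2, n − 2)`, `n` odd, Lie step)

Family `hodge`, layer `Literature/AlgebraicGeometry/Motives` (abstract polarizable `ℚ`-Hodge structures; no geometry).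
Research context: cell `pub-hodge-ring2` (HONEST FRAMING: research route conditional on HC_CM; not a corollary;
Q11.4-sentence-2 already refuted in dim ≥ 3), Literature lane (lit gen 83, programme R61). UNCONDITIONAL Hodge–Lie linear
algebra; theorems only, no definition, no named fact (D-0026), no `sorry`. This is the `(2, b)`, `b` odd, companion of
the tree's `(m,1)` file `HodgeThetaSubalgebraUnitary` (THEOREM L′) and `(2,3)` file `HodgeThetaSubalgebraUnitaryTwoThree`
(THEOREM L″): Serre's lemma in Ribet's Theorem 3 is replaced by the classification-free Hermitian core
`UnitaryTwoOdd.eq_top` / `eq_top'` (`HodgeThetaSubalgebraUnitaryTwoOddCore`), whose extra input — a Hermitian form on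
`W = ker(φ_ℂ − μ)`, definite on `W^{1,0}` and on `W^{0,1}`, for which the restriction algebra is adjoint-closed — is
supplied here by the polarization: `s(x, y) = i·ψ_ℂ(x, conj y)` (Hodge–Riemann), the adjoint of `Z|_W` being
`−(conj ∘ Z ∘ conj)|_W` (Deligne, LNM 900, I §3: `ad C` is a Cartan involution).

SETTING (as in the `(m,1)` and `(2,3)` files). `H` an effective polarizable `ℚ`-Hodge structure of weight `1` on `V`, `ψ`
a polarization, `φ ∈ E = End_Hdg(V)` with `φ² = -d` (`d > 0`) and `E = ℚ + ℚφ` (`End⁰ = k` imaginary quadratic);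
`μ² = -d`, `W = ker(φ_ℂ − μ)`, and the MULTIPLICITY HYPOTHESIS `{dim W^{1,0}, dim W^{0,1}} = {2, b}` with `b` odd
(an abelian variety of odd dimension `g = b + 2` on which `k` acts with multiplicities `(2, g − 2)`).

PROVED HERE.
* **`UnitaryThetaTwoOdd.mem_spanC_of_commute_of_skew`** — for ANY bracket-closed `ℚ`-subspace `𝔤 ⊆ 𝔲_K(V,ψ)` whose
  complex span contains an operator `Θ` acting by `2p − 1` on `V^{p,1−p}`: every `Y ∈ End(V_ℂ)` commuting with `φ_ℂ`
  and `ψ_ℂ`-skew lies in `𝔤_ℂ` — **`𝔤_ℂ = 𝔲_K(V,ψ)_ℂ`**. Proof: the restrictions of `𝔤_ℂ` to `W` form a bracket-closed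
  `𝔊 ⊆ End(W)` containing `Θ|_W`, acting irreducibly (`UnitaryTheta.eq_bot_or_eq_of_stable`), and closed under the
  adjoint for `s` (`conjOp_mem_spanC`); so `𝔊 = End(W)` by the core; then `Y|_W = Z|_W` for some `Z ∈ 𝔤_ℂ` and `Z = Y`
  by determination on `W` (`UnitaryTheta.eq_zero_of_forall_mem_eigenspace`).
* **`UnitaryThetaTwoOdd.wordDerAt_eq_zero_of_commute_of_skew`** — THEOREM L‴: a rational coefficient tensor killed
  slice-wise by the matrix of `Θ` is killed by the matrix of every `ψ_ℂ`-skew operator commuting with `φ_ℂ` (verbatim the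
  `(2,3)` proof).

## References
* [Ribet1983] K. A. Ribet, *Hodge classes on certain types of abelian varieties*, Amer. J. Math. 105 (1983), Thm. 3.
* [Gordon1997] B. B. Gordon, *A survey of the Hodge conjecture for abelian varieties*, Thm. 6.3 (3) and pp. 18–19.
* [Deligne1982HodgeCycles] P. Deligne, *Hodge cycles on abelian varieties*, LNM 900 (1982), I §3 (Prop. 3.4, 3.6).
* [MoonenZarhin1999LowDim] B. Moonen, Yu. Zarhin, Math. Ann. 315 (1999), §2 (2.4) and Thm. (2.7), §3 (3.1).
* [VoisinHodgeI2002] C. Voisin, *Hodge Theory and Complex Algebraic Geometry I*, §7.1.2 (Hodge–Riemann relations).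
-/

noncomputable section

open scoped TensorProduct

namespace Literature.AlgebraicGeometry.Motives

namespace HodgeStructure

section Main

universe u

variable {V : Type u} [AddCommGroup V] [Module ℚ V] {n : ℤ}

/-- **`𝔤_ℂ ⊇ 𝔲_K(V, ψ)_ℂ` for multiplicities `(2, b)` or `(b, 2)`, `b` odd — the main theorem.** (Module docstring.)
[cite: Ribet1983, Thm. 3] [cite: Gordon1997, Thm. 6.3 (3) and §6 (pp. 18–19)] [cite: Deligne1982HodgeCycles, I §3 Prop. 3.4, 3.6]
[cite: MoonenZarhin1999LowDim, §2 (2.4) and Thm. (2.7)] -/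
theorem UnitaryThetaTwoOdd.mem_spanC_of_commute_of_skew [Module.Finite ℚ V] (H : HodgeStructure V n)
    (hn : n = 1) (heff : H.IsEffective) (ψ : H.Polarization) {φ : Module.End ℚ V} (hφE : φ ∈ H.endAlg)
    {d : ℚ} (hd : 0 < d) (hφ2 : φ * φ = -(d • 1)) (hE : ∀ a ∈ H.endAlg, ∃ x y : ℚ, a = x • 1 + y • φ)
    {μ : ℂ} (hμ : μ ^ 2 = -(d : ℂ))
    (h2b : (Module.finrank ℂ ↥(Module.End.eigenspace (φ.baseChange ℂ) μ ⊓ H.piece 1 0) = 2 ∧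
        Odd (Module.finrank ℂ ↥(Module.End.eigenspace (φ.baseChange ℂ) μ ⊓ H.piece 0 1))) ∨
      (Odd (Module.finrank ℂ ↥(Module.End.eigenspace (φ.baseChange ℂ) μ ⊓ H.piece 1 0)) ∧
        Module.finrank ℂ ↥(Module.End.eigenspace (φ.baseChange ℂ) μ ⊓ H.piece 0 1) = 2))
    (𝔤 : Submodule ℚ (Module.End ℚ V)) (hbr : ∀ X ∈ 𝔤, ∀ X' ∈ 𝔤, X * X' - X' * X ∈ 𝔤)
    {Θ : Module.End ℂ (ℂ ⊗[ℚ] V)} (hΘ : ∀ p, ∀ x ∈ H.piece p (n - p), Θ x = ((2 * p - n : ℤ) : ℂ) • x)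
    (hΘ𝔤 : Θ ∈ spanC 𝔤)
    (hcomm : ∀ X ∈ 𝔤, ∀ a : H.endAlg, X * (a : Module.End ℚ V) = (a : Module.End ℚ V) * X)
    (hskew : ∀ X ∈ 𝔤, ∀ v w, ψ.form (X v) w + ψ.form v (X w) = 0)
    {Y : Module.End ℂ (ℂ ⊗[ℚ] V)} (hYφ : Y * φ.baseChange ℂ = φ.baseChange ℂ * Y)
    (hYskew : ∀ x y, ψ.form.baseChange ℂ (Y x) y + ψ.form.baseChange ℂ x (Y y) = 0) :
    Y ∈ spanC 𝔤 := by
  classical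
  obtain ⟨hPhat, hQhat, hΘ10, hΘ01, hΘΘ⟩ := UnitaryTheta.theta_facts H hn heff hΘ
  set W := Module.End.eigenspace (φ.baseChange ℂ) μ with hWdef
  have h𝔊W : ∀ Z ∈ spanC 𝔤, ∀ s ∈ W, Z s ∈ W := fun Z hZ s hs =>
    UnitaryTheta.apply_mem_eigenspace_of_commute (UnitaryTheta.commute_of_mem_spanC H hφE hcomm hZ) hs
  have h𝔊br : ∀ Z ∈ spanC 𝔤, ∀ Z' ∈ spanC 𝔤, Z * Z' - Z' * Z ∈ spanC 𝔤 := fun Z hZ Z' hZ' =>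
    commutator_mem_spanC hbr hZ hZ'
  -- a non-zero vector of `W`, hence `V` is nontrivial
  have hWpos : 0 < Module.finrank ℂ ↥(W ⊓ H.piece 1 0) := by
    rcases h2b with ⟨h, -⟩ | ⟨⟨k, hk⟩, -⟩ <;> omega
  haveI : Nontrivial ↥(W ⊓ H.piece 1 0) := Module.nontrivial_of_finrank_pos (R := ℂ) hWpos
  obtain ⟨⟨x₀, hx₀⟩, hx₀0⟩ := exists_ne (0 : ↥(W ⊓ H.piece 1 0))
  have hx₀0' : x₀ ≠ 0 := fun h => hx₀0 (Subtype.ext h)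
  haveI : Nontrivial V := by
    by_contra hV
    have hsub : Subsingleton V := not_nontrivial_iff_subsingleton.1 hV
    have hzero : ∀ x : ℂ ⊗[ℚ] V, x = 0 := fun x => by
      induction x using TensorProduct.induction_on with
      | zero => rfl
      | tmul c v => rw [Subsingleton.elim v 0, TensorProduct.tmul_zero]
      | add x y hx hy => rw [hx, hy, add_zero]
    exact hx₀0' (hzero x₀)
  -- the restricted Lie algebra `𝔊 ⊆ End(W)`
  set 𝔊 : Submodule ℂ (Module.End ℂ W) :=
    { carrier := {F | ∃ Z ∈ spanC 𝔤, ∀ w : W, (F w : ℂ ⊗[ℚ] V) = Z w}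
      zero_mem' := ⟨0, Submodule.zero_mem _, fun w => by simp⟩
      add_mem' := by
        rintro F F' ⟨Z, hZ, hF⟩ ⟨Z', hZ', hF'⟩
        exact ⟨Z + Z', Submodule.add_mem _ hZ hZ', fun w => by
          rw [LinearMap.add_apply, Submodule.coe_add, hF, hF', LinearMap.add_apply]⟩
      smul_mem' := by
        rintro c F ⟨Z, hZ, hF⟩
        exact ⟨c • Z, Submodule.smul_mem _ c hZ, fun w => by
          rw [LinearMap.smul_apply, Submodule.coe_smul, hF, LinearMap.smul_apply]⟩ } with h𝔊def
  have hmem𝔊 : ∀ F, F ∈ 𝔊 ↔ ∃ Z ∈ spanC 𝔤, ∀ w : W, (F w : ℂ ⊗[ℚ] V) = Z w := fun F => Iff.rfl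
  have hres : ∀ Z ∈ spanC 𝔤, ∃ F ∈ 𝔊, ∀ w : W, (F w : ℂ ⊗[ℚ] V) = Z w := fun Z hZ =>
    ⟨Z.restrict fun s hs => h𝔊W Z hZ s hs, ⟨Z, hZ, fun w => rfl⟩, fun w => rfl⟩
  have hbr𝔊 : ∀ F ∈ 𝔊, ∀ F' ∈ 𝔊, F * F' - F' * F ∈ 𝔊 := by
    intro F hF F' hF'
    obtain ⟨Z, hZ, hFZ⟩ := (hmem𝔊 F).1 hF
    obtain ⟨Z', hZ', hFZ'⟩ := (hmem𝔊 F').1 hF'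
    refine (hmem𝔊 _).2 ⟨Z * Z' - Z' * Z, h𝔊br Z hZ Z' hZ', fun w => ?_⟩
    rw [LinearMap.sub_apply, Submodule.coe_sub, Module.End.mul_apply, Module.End.mul_apply, hFZ, hFZ', hFZ', hFZ,
      LinearMap.sub_apply, Module.End.mul_apply, Module.End.mul_apply]
  -- `Θ|_W`
  set ΘW : Module.End ℂ W := Θ.restrict fun s hs => h𝔊W Θ hΘ𝔤 s hs with hΘWdef
  have hΘWapply : ∀ w : W, (ΘW w : ℂ ⊗[ℚ] V) = Θ w := fun w => rfl
  have hΘW𝔊 : ΘW ∈ 𝔊 := (hmem𝔊 _).2 ⟨Θ, hΘ𝔤, hΘWapply⟩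
  have hΘWΘW : ΘW * ΘW = 1 := LinearMap.ext fun w => Subtype.ext (by
    rw [Module.End.mul_apply, hΘWapply, hΘWapply, hΘΘ, Module.End.one_apply])
  -- irreducibility of `W` under `𝔊`
  have hirr𝔊 : ∀ U : Submodule ℂ W, (∀ F ∈ 𝔊, ∀ u ∈ U, F u ∈ U) → U = ⊥ ∨ U = ⊤ := by
    intro U hU
    have hU' : ∀ X ∈ 𝔤, ∀ u ∈ U.map W.subtype, X.baseChange ℂ u ∈ U.map W.subtype := by
      rintro X hX _ ⟨u, hu, rfl⟩
      obtain ⟨F, hF, hFZ⟩ := hres _ (baseChange_mem_spanC hX)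
      exact ⟨F u, hU F hF u hu, hFZ u⟩
    rcases UnitaryTheta.eq_bot_or_eq_of_stable H hn heff ψ hφE hd hφ2 hE hμ 𝔤 hΘ hΘ𝔤 hcomm hskew
        (U := U.map W.subtype) (Submodule.map_subtype_le W U) hU' with h | h
    · left
      rw [eq_bot_iff]
      intro u hu
      rw [Submodule.mem_bot]
      apply Subtype.ext
      have : (u : ℂ ⊗[ℚ] V) ∈ U.map W.subtype := ⟨u, hu, rfl⟩
      rw [h, Submodule.mem_bot] at this
      exact this
    · right
      rw [eq_top_iff]
      intro w _
      have hw : (w : ℂ ⊗[ℚ] V) ∈ U.map W.subtype := by rw [h]; exact w.2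
      obtain ⟨u, hu, huw⟩ := hw
      have : u = w := Subtype.ext huw
      exact this ▸ hu
  -- the eigenspaces of `Θ|_W` and their dimensions
  set PW : Submodule ℂ W := LinearMap.ker (ΘW - 1) with hPWdef
  set QW : Submodule ℂ W := LinearMap.ker (ΘW + 1) with hQWdef
  have hPW : ∀ x, x ∈ PW ↔ ΘW x = x := fun x => by
    rw [hPWdef, LinearMap.mem_ker, LinearMap.sub_apply, Module.End.one_apply, sub_eq_zero]
  have hQW : ∀ x, x ∈ QW ↔ ΘW x = -x := fun x => by
    rw [hQWdef, LinearMap.mem_ker, LinearMap.add_apply, Module.End.one_apply, add_eq_zero_iff_eq_neg]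
  have hPWmem : ∀ x : W, x ∈ PW ↔ (x : ℂ ⊗[ℚ] V) ∈ H.piece 1 0 := fun x => by
    rw [hPW]
    constructor
    · intro h
      have hx : Θ x = x := by rw [← hΘWapply, h]
      have hx' : (x : ℂ ⊗[ℚ] V) = (2 : ℂ)⁻¹ • ((x : ℂ ⊗[ℚ] V) + Θ x) := by rw [hx]; module
      rw [hx']
      exact hPhat _
    · intro hx10
      apply Subtype.ext
      rw [hΘWapply]
      exact hΘ10 _ hx10
  have hQWmem : ∀ x : W, x ∈ QW ↔ (x : ℂ ⊗[ℚ] V) ∈ H.piece 0 1 := fun x => by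
    rw [hQW]
    constructor
    · intro h
      have hx : Θ x = -x := by rw [← hΘWapply, h, Submodule.coe_neg]
      have hx' : (x : ℂ ⊗[ℚ] V) = (2 : ℂ)⁻¹ • ((x : ℂ ⊗[ℚ] V) - Θ x) := by rw [hx]; module
      rw [hx']
      exact hQhat _
    · intro hx01
      apply Subtype.ext
      rw [hΘWapply, Submodule.coe_neg]
      exact hΘ01 _ hx01
  have hPWeq : PW = Submodule.comap W.subtype (W ⊓ H.piece 1 0) := by
    ext x
    rw [hPWmem, Submodule.mem_comap, Submodule.subtype_apply, Submodule.mem_inf]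
    exact ⟨fun h => ⟨x.2, h⟩, fun h => h.2⟩
  have hQWeq : QW = Submodule.comap W.subtype (W ⊓ H.piece 0 1) := by
    ext x
    rw [hQWmem, Submodule.mem_comap, Submodule.subtype_apply, Submodule.mem_inf]
    exact ⟨fun h => ⟨x.2, h⟩, fun h => h.2⟩
  have hfinP : Module.finrank ℂ PW = Module.finrank ℂ ↥(W ⊓ H.piece 1 0) := by
    rw [hPWeq]; exact (Submodule.comapSubtypeEquivOfLe inf_le_left).finrank_eq
  have hfinQ : Module.finrank ℂ QW = Module.finrank ℂ ↥(W ⊓ H.piece 0 1) := by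
    rw [hQWeq]; exact (Submodule.comapSubtypeEquivOfLe inf_le_left).finrank_eq
  -- the Hermitian form `s(x, y) = i ψ_ℂ(x, conj y)` on `W` (Hodge–Riemann)
  set ω := ψ.form.baseChange ℂ with hω
  subst hn
  have hswap : ∀ x y, ω y x = -ω x y := form_baseChange_swap_of_odd H odd_one ψ
  set s : W → W → ℂ := fun x y => Complex.I * ω x (conj (y : ℂ ⊗[ℚ] V)) with hsdef
  have hsapply : ∀ x y : W, s x y = Complex.I * ω x (conj (y : ℂ ⊗[ℚ] V)) := fun x y => rfl
  have hadd : ∀ x y z : W, s (x + y) z = s x z + s y z := fun x y z => by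
    rw [hsapply, hsapply, hsapply, Submodule.coe_add, map_add, LinearMap.add_apply, mul_add]
  have hsymm : ∀ x y : W, s y x = starRingEnd ℂ (s x y) := fun x y => by
    rw [hsapply, hsapply, map_mul, Complex.conj_I, ← form_baseChange_conj, conj_conj, hswap, neg_mul, mul_neg]
  have hPQ : ∀ p ∈ PW, ∀ q ∈ QW, s p q = 0 := fun p hp q hq => by
    have hp' := (hPWmem p).1 hp
    have hq' := (hQWmem q).1 hq
    rw [hsapply, hω, ψ.form_apply_eq_zero 1 _ (H.piece_le_F 1 0 hp') _ (by
      have h := H.piece_le_F 1 0 (conj_mem_piece H hq')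
      simpa using h), mul_zero]
  have hdefP : ∀ p ∈ PW, s p p = 0 → p = 0 := fun p hp h0 => by
    by_contra hne
    have hne' : (p : ℂ ⊗[ℚ] V) ≠ 0 := fun h => hne (Subtype.ext h)
    obtain ⟨r, hr, hre⟩ := ψ.pos 1 0 (by norm_num) _ ((hPWmem p).1 hp) hne'
    rw [hsapply] at h0
    have h1 : (r : ℂ) = 0 := by rw [← hre, ← hω]; simpa using h0
    exact hr.ne' (by exact_mod_cast h1)
  have hdefQ : ∀ q ∈ QW, s q q = 0 → q = 0 := fun q hq h0 => by
    by_contra hne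
    have hne' : (q : ℂ ⊗[ℚ] V) ≠ 0 := fun h => hne (Subtype.ext h)
    obtain ⟨r, hr, hre⟩ := ψ.pos 0 1 (by norm_num) _ ((hQWmem q).1 hq) hne'
    rw [hsapply, mul_eq_zero] at h0
    have hω0 : ω q (conj (q : ℂ ⊗[ℚ] V)) = 0 := h0.resolve_left Complex.I_ne_zero
    rw [hω] at hω0
    have h1 : (r : ℂ) = 0 := by rw [← hre, hω0, mul_zero]
    exact hr.ne' (by exact_mod_cast h1)
  have hadj : ∀ F ∈ 𝔊, ∃ G ∈ 𝔊, ∀ x y : W, s (F x) y = s x (G y) := by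
    intro F hF
    obtain ⟨Z, hZ, hFZ⟩ := (hmem𝔊 F).1 hF
    obtain ⟨Zb, hZb⟩ := exists_conjOp Z
    have hZb𝔤 : Zb ∈ spanC 𝔤 := conjOp_mem_spanC hZ hZb
    obtain ⟨G, hG, hGZ⟩ := hres (-Zb) (Submodule.neg_mem _ hZb𝔤)
    refine ⟨G, hG, fun x y => ?_⟩
    have hskZ : ∀ a b, ω (Z a) b = -ω a (Z b) := fun a b =>
      eq_neg_of_add_eq_zero_left (ThetaSubalgebra.formBaseChange_add_eq_zero_of_mem_spanC ψ hskew hZ a b)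
    have hconjZb : conj (Zb y) = Z (conj (y : ℂ ⊗[ℚ] V)) := by rw [hZb, conj_conj]
    rw [hsapply, hsapply, hFZ, hGZ, hskZ, LinearMap.neg_apply, map_neg, hconjZb, map_neg, mul_neg]
  -- `𝔊 = End(W)` by the Hermitian core
  have htop : 𝔊 = ⊤ := by
    rcases h2b with ⟨h2, hb⟩ | ⟨hb, h2⟩
    · exact UnitaryTwoOdd.eq_top hbr𝔊 hirr𝔊 hΘW𝔊 hΘWΘW hPW hQW (by rw [hfinP, h2]) (by rw [hfinQ]; exact hb) hadd
        hsymm hPQ hdefP hdefQ hadj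
    · exact UnitaryTwoOdd.eq_top' hbr𝔊 hirr𝔊 hΘW𝔊 hΘWΘW hPW hQW (by rw [hfinP]; exact hb) (by rw [hfinQ, h2]) hadd
        hsymm hPQ hdefP hdefQ hadj
  -- `Y|_W` is induced by some `Z ∈ 𝔤_ℂ`
  have hYW : ∀ w ∈ W, Y w ∈ W := fun w hw => UnitaryTheta.apply_mem_eigenspace_of_commute hYφ hw
  obtain ⟨Z, hZ, hZY⟩ := (hmem𝔊 (Y.restrict hYW)).1 (htop ▸ Submodule.mem_top)
  -- and `Y = Z` by determination on `W`
  have hD := UnitaryTheta.eq_zero_of_forall_mem_eigenspace H ψ hφE hd hφ2 hE hμ (D := Z - Y)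
    (by rw [sub_mul, mul_sub, UnitaryTheta.commute_of_mem_spanC H hφE hcomm hZ, hYφ])
    (fun x y => by
      have h3 := ThetaSubalgebra.formBaseChange_add_eq_zero_of_mem_spanC ψ hskew hZ x y
      have h4 := hYskew x y
      rw [LinearMap.sub_apply, LinearMap.sub_apply, map_sub, LinearMap.sub_apply, map_sub]
      linear_combination h3 - h4)
    (fun w hw => by
      rw [LinearMap.sub_apply, sub_eq_zero, ← hZY ⟨w, hw⟩]
      rfl)
  rw [sub_eq_zero] at hD
  exact hD ▸ hZ

end Main

/-! ### Theorem L‴: rational tensors killed by `Θ` are killed by `𝔲_K(V, ψ)_ℂ`, multiplicities `(2, b)`, `b` odd -/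

section AnnLie

open Literature.RepresentationTheory.GeneralLinear Literature.NumberTheory.DiophantineGeometry

universe u

variable {V : Type u} [AddCommGroup V] [Module ℚ V] {n : ℤ} {M N k : ℕ}

/-- **THEOREM L‴ (invariance of rational tensors under `𝔲_K(V, ψ)_ℂ`; Lie step of Ribet's `Hdg(Aⁿ) = Div(Aⁿ)` at
multiplicities `(2, b)`, `b` odd).** In the setting of `UnitaryThetaTwoOdd.mem_spanC_of_commute_of_skew`, a rational
coefficient tensor `q` killed — slice by slice, diagonally — by the matrix of the Hodge operator `Θ` is killed by the
matrix of EVERY `ψ_ℂ`-skew operator `Y` of `V_ℂ` commuting with `φ_ℂ` (verbatim the `(2,3)` proof: the rational annihilator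
Lie algebra `annLie` is bracket-closed, commutes with `E`, is `ψ`-skew and has `Θ` in its complex span, `mem_spanC_annLie`).
[cite: Ribet1983, Thm. 3] [cite: Gordon1997, Thm. 6.3 (3) and §6 (pp. 18–19)] [cite: Deligne1982HodgeCycles, I §3 (proof of Prop. 3.4)]
[cite: MoonenZarhin1999LowDim, §2 (2.4) and §3 (3.1)] -/
theorem UnitaryThetaTwoOdd.wordDerAt_eq_zero_of_commute_of_skew [Module.Finite ℚ V] [HodgeTensorFacts.{u, u}]
    (H : HodgeStructure V n) (hn : n = 1) (heff : H.IsEffective) (ψ : H.Polarization) {φ : Module.End ℚ V}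
    (hφE : φ ∈ H.endAlg) {d : ℚ} (hd : 0 < d) (hφ2 : φ * φ = -(d • 1))
    (hE : ∀ a ∈ H.endAlg, ∃ x y : ℚ, a = x • 1 + y • φ) {μ : ℂ} (hμ : μ ^ 2 = -(d : ℂ))
    (h2b : (Module.finrank ℂ ↥(Module.End.eigenspace (φ.baseChange ℂ) μ ⊓ H.piece 1 0) = 2 ∧
        Odd (Module.finrank ℂ ↥(Module.End.eigenspace (φ.baseChange ℂ) μ ⊓ H.piece 0 1))) ∨
      (Odd (Module.finrank ℂ ↥(Module.End.eigenspace (φ.baseChange ℂ) μ ⊓ H.piece 1 0)) ∧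
        Module.finrank ℂ ↥(Module.End.eigenspace (φ.baseChange ℂ) μ ⊓ H.piece 0 1) = 2))
    (eQ : Module.Basis (Fin M) ℚ V) (q : (Fin N → Fin k × Fin M) → ℚ) {Θ : Module.End ℂ (ℂ ⊗[ℚ] V)}
    (hΘ : ∀ p, ∀ x ∈ H.piece p (n - p), Θ x = ((2 * p - n : ℤ) : ℂ) • x)
    (hΘq : ∀ u : Fin N → Fin k, wordDerAt ℂ (fun _ : Fin N =>
      LinearMap.toMatrix (Algebra.TensorProduct.basis ℂ eQ) (Algebra.TensorProduct.basis ℂ eQ) Θ)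
      (wordSlice (fun w => algebraMap ℚ ℂ (q w)) u) = 0)
    {Y : Module.End ℂ (ℂ ⊗[ℚ] V)} (hYφ : Y * φ.baseChange ℂ = φ.baseChange ℂ * Y)
    (hYskew : ∀ x y, ψ.form.baseChange ℂ (Y x) y + ψ.form.baseChange ℂ x (Y y) = 0)
    (u : Fin N → Fin k) :
    wordDerAt ℂ (fun _ : Fin N =>
      LinearMap.toMatrix (Algebra.TensorProduct.basis ℂ eQ) (Algebra.TensorProduct.basis ℂ eQ) Y)
      (wordSlice (fun w => algebraMap ℚ ℂ (q w)) u) = 0 := by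
  set 𝔞 : Submodule ℚ (Module.End ℚ V) := annLie ψ.form eQ (fun a : H.endAlg => (a : Module.End ℚ V)) q
    with h𝔞
  have hΘC : Θ ∈ H.hodgeLieC := H.mem_hodgeLieC_of_forall_piece hΘ
  have hΘ𝔞 : Θ ∈ spanC 𝔞 :=
    mem_spanC_annLie ψ.form eQ _ q hΘq (fun a => commute_baseChange_of_mem_hodgeLieC H hΘC a)
      fun x y => by rw [formBaseChange_skew_of_mem_hodgeLieC ψ hΘC, neg_add_cancel]
  have hbr : ∀ X ∈ 𝔞, ∀ X' ∈ 𝔞, X * X' - X' * X ∈ 𝔞 := fun X hX X' hX' =>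
    commutator_mem_annLie ψ.form eQ _ q hX hX'
  have hcomm : ∀ X ∈ 𝔞, ∀ a : H.endAlg, X * (a : Module.End ℚ V) = (a : Module.End ℚ V) * X :=
    fun X hX a => ((mem_annLie_iff ψ.form eQ _ q X).1 hX).2.1 a
  have hskew : ∀ X ∈ 𝔞, ∀ v w, ψ.form (X v) w + ψ.form v (X w) = 0 :=
    fun X hX => ((mem_annLie_iff ψ.form eQ _ q X).1 hX).2.2
  have hY : Y ∈ spanC 𝔞 :=
    UnitaryThetaTwoOdd.mem_spanC_of_commute_of_skew H hn heff ψ hφE hd hφ2 hE hμ h2b 𝔞 hbr hΘ hΘ𝔞 hcomm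
      hskew hYφ hYskew
  rw [h𝔞] at hY
  exact wordDerAt_eq_zero_of_mem_spanC_annLie ψ.form eQ _ q hY u

end AnnLie

end HodgeStructure

end Literature.AlgebraicGeometry.Motives

end
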